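import Literature.AlgebraicGeometry.HodgeTheory.FermatSurfaceModelCharts
import Literature.AlgebraicGeometry.HodgeTheory.FermatSurfaceModelFibres
import Literature.Analysis.Complex.RotationEigenfunctionOrder
import HarnessLib

/-!
# Holomorphic models of the Fermat surface: the invariant quotient function decays at the fibre at infinity of a line

Family `hodge`, layer `Literature/AlgebraicGeometry/HodgeTheory`. PROOF FILE (theorems only; no
definition, no named fact — D-0026), continuing `FermatSurfaceModelFibres` /
`FermatSurfaceModelCharts` on the path of the analytic leaf `hmodel` of
`AokiShioda1983_eigenline_le_neronSeveri_holds_of_modelEigenforms`. Data: a holomorphic model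
`(ψ, Φ)` of the Fermat surface; two functions `f₀` on `M₀` and `f₁` on `M₁` related on the
overlap by the cocycle of `K = 𝒪(m − 4)`, `f₀ · (x₀/x₁)^{m−4} = f₁` (the ratio functions of ONE
holomorphic `2`-form against the two affine volume forms, `fermatRatio_zero_mul_zpow_eq_one`),
`f₁` continuous at the points of `M₁`, and the quotient `F = f₀ / ∏_r y_r^{⟨β_r⟩ − 1}` with
`⟨β₁⟩ + ⟨β₂⟩ + ⟨β₃⟩ ≥ m` — for a Hodge character `β ∈ 𝔅²ₘ` (`Σ⟨β_r⟩ = 2m`, `⟨β₀⟩ ≤ m − 1`) this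
sum is `≥ m + 1`. In the coordinates `z = Z̃₁ = x/x₁` of `M₁` one has `y_r = z_r/z₀` and
`F = f₁ · z₀^{N} / (z₂^{⟨β₂⟩−1} z₃^{⟨β₃⟩−1})` with `N = 1 + ⟨β₁⟩ + ⟨β₂⟩ + ⟨β₃⟩ − m ≥ 1`, so
**`F → 0` at the points of `{x₀ = 0}`** — this is where the LENGTH of the character enters
(for `|β| = 1` the exponent `N` is `0` and `F` tends to the non-zero constant giving
`Res(x^c Ω/F)`). Proved here:

* `norm_fermatQuotientFn_le_near_infinity` — the estimate
  `‖F x‖ ≤ ‖f₁ x‖ · ‖z₀‖ / (‖z₂‖^{⟨β₂⟩−1} ‖z₃‖^{⟨β₃⟩−1})` on `M₀ ∩ M₁` where `‖z₀‖ ≤ 1`;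
* `exists_small_near_infinityFibre` — **along the line `z₂ᵐ = μ z₀ᵐ + λ` (the line
  `u₂ = λ u₁ + μ u₀` read at `u₁ = 1`; `λ ≠ 0, −1`), for every `ε > 0` there is `δ > 0` with
  `‖F x‖ ≤ ε` for all `x ∈ M₀ ∩ M₁` with no vanishing `y`-coordinate, `‖z₀(x)‖ < δ` and
  `z₂(x)ᵐ = μ z₀(x)ᵐ + λ`** — via one lifted curve `Γ` through a point `p∞ = [0:1:c₀:c₀']` of
  the fibre at infinity (`exists_coordChart` for `(z₀, z₂)` on `M₁`, `exists_liftedCurve`), along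
  which the estimate tends to `0`, and the fibre constancy of `F` (`fermatQuotientFn_eq_of_pow_eq`).

## References

* [Shioda1979HodgeFermat] T. Shioda, The Hodge conjecture for Fermat varieties, Math. Ann. 245
  (1979) 175–184, §1 (1.7) (the length `|β|` of a character).
* [Hartshorne1977] R. Hartshorne, Algebraic Geometry (1977), II Example 8.20.3.
-/

noncomputable section

open scoped Manifold ContDiff Topology LinearAlgebra.Projectivization
open Set Filter Projectivization Function

namespace Literature.AlgebraicGeometry.HodgeTheory

open Literature.AlgebraicGeometry.Motives Literature.NumberTheory.Transcendental
  Literature.Geometry.Kaehler Literature.Analysis.Complex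

/-! ### Real bookkeeping: `t^{4−m} · t^{c₁+c₂+c₃} ≤ t` for `t ≤ 1` -/

/-- For `0 < t ≤ 1` and naturals with `m ≤ c₁ + c₂ + c₃ + 3`:
`t^{(4:ℤ) − m} · t^{c₁ + c₂ + c₃} ≤ t` (the exponent `4 − m + c₁ + c₂ + c₃` is `≥ 1`).
[folklore] -/
theorem zpow_four_sub_mul_pow_le {t : ℝ} (ht0 : 0 < t) (ht1 : t ≤ 1) {m c : ℕ} (hc : m ≤ c + 3) :
    t ^ ((4 : ℤ) - m) * t ^ c ≤ t := by
  rw [← zpow_natCast, ← zpow_add₀ ht0.ne']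
  have h1 : (1 : ℤ) ≤ (4 : ℤ) - m + c := by omega
  calc t ^ ((4 : ℤ) - m + c) ≤ t ^ (1 : ℤ) := zpow_le_zpow_right_of_le_one₀ ht0 ht1 h1
    _ = t := zpow_one t

section Surface

variable {m : ℕ} {E : Type*} [NormedAddCommGroup E] [NormedSpace ℂ E] [FiniteDimensional ℂ E]
  {M : Type*} [TopologicalSpace M] [ChartedSpace E M] [IsManifold 𝓘(ℂ, E) ω M]
  {ψ : M → ℙ ℂ (Fin (2 + 2) → ℂ)} {Φ : fermatGroup 2 m → M → M}

/-! ### The estimate near the fibre at infinity -/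

omit [FiniteDimensional ℂ E] [TopologicalSpace M] [ChartedSpace E M] [IsManifold 𝓘(ℂ, E) ω M] in
/-- **`‖F x‖ ≤ ‖f₁ x‖ · ‖z₀‖ / (‖z₂‖^{⟨β₂⟩−1} ‖z₃‖^{⟨β₃⟩−1})` on `M₀ ∩ M₁` where `‖z₀‖ ≤ 1`**,
for `F = f₀/∏ y_r^{⟨β_r⟩−1}`, `f₀ z₀^{m−4} = f₁` and `⟨β₁⟩ + ⟨β₂⟩ + ⟨β₃⟩ ≥ m`: with
`y_r = z_r/z₀` (`Z̃₀ = z₀⁻¹ Z̃₁`), `‖F‖ = ‖f₁‖ ‖z₀‖^{4−m} ‖z₀‖^{c₁+c₂+c₃} / (‖z₂‖^{c₂}‖z₃‖^{c₃})`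
and the power of `‖z₀‖ ≤ 1` has exponent `≥ 1`. [cite: Shioda1979HodgeFermat, §1 (1.7)]
[cite: Hartshorne1977, II Example 8.20.3] -/
theorem norm_fermatQuotientFn_le_near_infinity {β : Fin (2 + 2) → ZMod m}
    (hN : m ≤ (β 1).val + (β 2).val + (β 3).val) (hb : ∀ r, r ≠ 0 → 1 ≤ (β r).val)
    {f₀ f₁ Fq : M → ℂ} (hFq : ∀ x, Fq x = f₀ x / ∏ r, projLift ψ 0 x r ^ ((β r).val - 1))
    {x : M} (hx₀ : x ∈ liftDomain ψ 0) (hx₁ : x ∈ liftDomain ψ 1)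
    (htrans : f₀ x * projLift ψ 1 x 0 ^ ((m : ℤ) - 4) = f₁ x) (hz1 : ‖projLift ψ 1 x 0‖ ≤ 1) :
    ‖Fq x‖ ≤ ‖f₁ x‖ * ‖projLift ψ 1 x 0‖ /
      (‖projLift ψ 1 x 2‖ ^ ((β 2).val - 1) * ‖projLift ψ 1 x 3‖ ^ ((β 3).val - 1)) := by
  set z := projLift ψ 1 x with hz
  set w : ℂ := z 0 with hw
  have hw0 : w ≠ 0 := by
    intro h0
    have := projLift_eq_smul_of_mem ψ hx₁ hx₀
    rw [← hz, ← hw, h0, inv_zero, zero_smul] at this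
    exact projLift_ne_zero ψ 0 x this
  set t : ℝ := ‖w‖ with ht
  have ht0 : 0 < t := norm_pos_iff.mpr hw0
  -- `y = w⁻¹ • z`
  have hy : projLift ψ 0 x = w⁻¹ • z := projLift_eq_smul_of_mem ψ hx₁ hx₀
  have hz1' : z 1 = 1 := projLift_apply_self ψ 1 x
  -- `‖f₀‖ = ‖f₁‖ t^{4-m}`
  have hf : ‖f₀ x‖ = ‖f₁ x‖ * t ^ ((4 : ℤ) - m) := by
    have h := congrArg (fun u : ℂ ↦ ‖u‖) htrans
    simp only [norm_mul, norm_zpow] at h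
    rw [← ht] at h
    rw [← h, mul_assoc, ← zpow_add₀ ht0.ne']
    have : ((m : ℤ) - 4) + ((4 : ℤ) - m) = 0 := by ring
    rw [this, zpow_zero, mul_one]
  -- the denominator
  set c : Fin (2 + 2) → ℕ := fun r ↦ (β r).val - 1 with hc
  have hden : ∏ r, ‖projLift ψ 0 x r‖ ^ c r =
      t ^ c 0 * (‖z 2‖ ^ c 2 * ‖z 3‖ ^ c 3) * t⁻¹ ^ (c 0 + c 1 + c 2 + c 3) := by
    have hyr : ∀ r, ‖projLift ψ 0 x r‖ = t⁻¹ * ‖z r‖ := fun r ↦ by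
      rw [hy, Pi.smul_apply, smul_eq_mul, norm_mul, norm_inv]
    simp_rw [hyr, mul_pow]
    rw [Finset.prod_mul_distrib, Finset.prod_pow_eq_pow_sum, Fin.prod_univ_four, Fin.sum_univ_four,
      hz1', norm_one, one_pow, mul_one, ← hw, ← ht]
    ring
  rw [hFq, norm_div, norm_prod]
  simp_rw [norm_pow]
  rw [hden, hf]
  -- compare
  have hZpos : 0 < ‖z 2‖ ^ c 2 * ‖z 3‖ ^ c 3 ∨ ‖z 2‖ ^ c 2 * ‖z 3‖ ^ c 3 = 0 := by
    rcases (mul_nonneg (pow_nonneg (norm_nonneg (z 2)) (c 2))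
      (pow_nonneg (norm_nonneg (z 3)) (c 3))).lt_or_eq with h | h
    · exact Or.inl h
    · exact Or.inr h.symm
  rcases hZpos with hZ | hZ
  · -- main case
    have hdenpos : 0 < t ^ c 0 * (‖z 2‖ ^ c 2 * ‖z 3‖ ^ c 3) * t⁻¹ ^ (c 0 + c 1 + c 2 + c 3) := by
      positivity
    rw [div_le_div_iff₀ hdenpos hZ]
    -- `‖f₁‖ t^{4-m} Z ≤ ‖f₁‖ t · (t^{c0} Z t⁻¹^{Σc})`
    have key : t ^ ((4 : ℤ) - m) * (‖z 2‖ ^ c 2 * ‖z 3‖ ^ c 3) ≤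
        t * (t ^ c 0 * (‖z 2‖ ^ c 2 * ‖z 3‖ ^ c 3) * t⁻¹ ^ (c 0 + c 1 + c 2 + c 3)) := by
      have hle := zpow_four_sub_mul_pow_le (m := m) ht0 hz1 (c := c 1 + c 2 + c 3)
        (by simp only [hc]; have := hb 1 (by decide); have := hb 2 (by decide);
            have := hb 3 (by decide); omega)
      have hpos : 0 < t ^ (c 1 + c 2 + c 3) := pow_pos ht0 _
      calc t ^ ((4 : ℤ) - m) * (‖z 2‖ ^ c 2 * ‖z 3‖ ^ c 3)
          = (t ^ ((4 : ℤ) - m) * t ^ (c 1 + c 2 + c 3)) * (‖z 2‖ ^ c 2 * ‖z 3‖ ^ c 3) *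
              (t ^ (c 1 + c 2 + c 3))⁻¹ := by field_simp
        _ ≤ t * (‖z 2‖ ^ c 2 * ‖z 3‖ ^ c 3) * (t ^ (c 1 + c 2 + c 3))⁻¹ := by gcongr
        _ = t * (t ^ c 0 * (‖z 2‖ ^ c 2 * ‖z 3‖ ^ c 3) * t⁻¹ ^ (c 0 + c 1 + c 2 + c 3)) := by
              rw [inv_pow]; field_simp; ring
    calc ‖f₁ x‖ * t ^ ((4 : ℤ) - m) * (‖z 2‖ ^ c 2 * ‖z 3‖ ^ c 3)
        = ‖f₁ x‖ * (t ^ ((4 : ℤ) - m) * (‖z 2‖ ^ c 2 * ‖z 3‖ ^ c 3)) := by ring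
      _ ≤ ‖f₁ x‖ * (t * (t ^ c 0 * (‖z 2‖ ^ c 2 * ‖z 3‖ ^ c 3) * t⁻¹ ^ (c 0 + c 1 + c 2 + c 3))) :=
          by gcongr
      _ = ‖f₁ x‖ * t * (t ^ c 0 * (‖z 2‖ ^ c 2 * ‖z 3‖ ^ c 3) * t⁻¹ ^ (c 0 + c 1 + c 2 + c 3)) :=
          by ring
  · -- degenerate case: both sides are `0 / 0`-shaped
    rw [hZ, mul_zero, zero_mul, div_zero, div_zero]

variable (hΦψ : ∀ (a : fermatGroup 2 m) (x : M), ψ (Φ a x) =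
    Projectivization.mk ℂ ((a : Fin (2 + 2) → ℂˣ) • (ψ x).rep)
      ((smul_ne_zero_iff_ne (a : Fin (2 + 2) → ℂˣ)).mpr (Projectivization.rep_nonzero _)))

include hΦψ in
/-- **`F` is small near the fibre at infinity of the line `z₂ᵐ = μ z₀ᵐ + λ`** (`λ ≠ 0, −1`).
Hypotheses: the model `(ψ, Φ)`; `⟨β_r⟩ ≥ 1` (`r ≠ 0`), `a₀^{Σ⟨β⟩} = 1` on `μₘ⁴`,
`⟨β₁⟩ + ⟨β₂⟩ + ⟨β₃⟩ ≥ m`; `f₀` with the `χ_β`-transformation law on `M₀` (fibre constancy of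
`F`), `f₁` continuous at the points of `M₁`, the cocycle relation `f₀ z₀^{m−4} = f₁` on
`M₀ ∩ M₁`; `F = f₀ / ∏ y_r^{⟨β_r⟩−1}`. Conclusion: for `ε > 0` some `δ > 0` has `‖F x‖ ≤ ε` for
all `x ∈ M₀ ∩ M₁` with all `y_r(x) ≠ 0`, `‖z₀(x)‖ < δ`, `z₂(x)ᵐ = μ z₀(x)ᵐ + λ`. Proof: through
`p∞ = [0 : 1 : c₀ : c₀']` (`c₀ᵐ = λ`, `c₀'ᵐ = −1 − λ`) runs the lifted curve `Γ` with `z₀ = s`,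
`z₂ = c(s)` (`cᵐ = μ sᵐ + λ`); along it the estimate `norm_fermatQuotientFn_le_near_infinity`
is `≤ K ‖s‖`, and every `x` as in the statement shares the fibre of `Γ(z₀ x)`.
[cite: Shioda1979HodgeFermat, §1 (1.7)] -/
theorem exists_small_near_infinityFibre [NeZero m] (hψ : Topology.IsEmbedding ψ)
    (hrange : Set.range ψ = projZeroLocus {fermatPolynomial ℂ 2 m}) (hhol : HasHolomorphicCoords E ψ)
    (h2 : Module.finrank ℂ E = 2) {β : Fin (2 + 2) → ZMod m} (hb : ∀ r, r ≠ 0 → 1 ≤ (β r).val)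
    (hsum : ∀ a : fermatGroup 2 m, (((a : Fin (2 + 2) → ℂˣ) 0 : ℂˣ) : ℂ) ^ (∑ r, (β r).val) = 1)
    (hN : m ≤ (β 1).val + (β 2).val + (β 3).val)
    {f₀ f₁ : M → ℂ} (hf₁c : ∀ x ∈ liftDomain ψ 1, ContinuousAt f₁ x)
    (hf₀ : ∀ (a : fermatGroup 2 m) (x : M), x ∈ liftDomain ψ 0 →
      f₀ (Φ a x) * ∏ r, ((((a : Fin (2 + 2) → ℂˣ) r : ℂˣ) : ℂ) / (((a : Fin (2 + 2) → ℂˣ) 0 : ℂˣ) : ℂ)) =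
        ((fermatCharacter m β a : ℂˣ) : ℂ) * f₀ x)
    (htrans : ∀ x, x ∈ liftDomain ψ 0 → x ∈ liftDomain ψ 1 →
      f₀ x * projLift ψ 1 x 0 ^ ((m : ℤ) - 4) = f₁ x)
    {Fq : M → ℂ} (hFq : ∀ x, Fq x = f₀ x / ∏ r, projLift ψ 0 x r ^ ((β r).val - 1))
    {lam : ℂ} (mu : ℂ) (hlam : lam ≠ 0) (hlam1 : 1 + lam ≠ 0) {ε : ℝ} (hε : 0 < ε) :
    ∃ δ > 0, ∀ x ∈ liftDomain ψ 0, x ∈ liftDomain ψ 1 → (∀ r, projLift ψ 0 x r ≠ 0) →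
      ‖projLift ψ 1 x 0‖ < δ → projLift ψ 1 x 2 ^ m = mu * projLift ψ 1 x 0 ^ m + lam →
        ‖Fq x‖ ≤ ε := by
  have hm : m ≠ 0 := NeZero.ne m
  have hmpos : 0 < m := Nat.pos_of_ne_zero hm
  have hψc := hψ.continuous
  have hinj := hψ.injective
  -- the point `p∞ = [0 : 1 : c₀ : c₀']`
  obtain ⟨c₀, hc₀⟩ := IsAlgClosed.exists_pow_nat_eq lam hmpos
  obtain ⟨c₀', hc₀'⟩ := IsAlgClosed.exists_pow_nat_eq (-(1 + lam)) hmpos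
  have hc₀0 : c₀ ≠ 0 := by rintro rfl; rw [zero_pow hm] at hc₀; exact hlam hc₀.symm
  have hc₀'0 : c₀' ≠ 0 := by
    rintro rfl; rw [zero_pow hm] at hc₀'; exact hlam1 (neg_eq_zero.mp hc₀'.symm)
  set v : Fin (2 + 2) → ℂ := ![0, 1, c₀, c₀'] with hv
  have hvsum : ∑ r, v r ^ m = 0 := by
    rw [Fin.sum_univ_four]
    simp [hv, zero_pow hm, hc₀, hc₀']
  obtain ⟨p, hp, hpv⟩ := exists_projLift_eq hrange (k := 1) (v := v) rfl hvsum
  have hp0 : projLift ψ 1 p 0 = 0 := by rw [hpv]; rfl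
  have hp2 : projLift ψ 1 p 2 = c₀ := by rw [hpv]; rfl
  have hp3 : projLift ψ 1 p 3 = c₀' := by rw [hpv]; rfl
  -- the chart `(z₀, z₂)` at `p` on `M₁`
  obtain ⟨e, hpe, hesrc, -, hesymm, he1⟩ := exists_coordChart (k := 1) (i := 0) (j := 2) (l := 3)
    hψ hrange.le hhol h2 (fun r ↦ by fin_cases r <;> simp) hp (by rw [hp3]; exact hc₀'0)
  -- the branch `c(s)ᵐ = μ sᵐ + λ`, `c 0 = c₀`, and the lifted curve
  obtain ⟨c, hcan, hc0, hcpow, -⟩ := exists_analyticAt_pow_eq hm mu hlam hc₀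
  obtain ⟨Γ, hΓ0, hΓd0, hΓev⟩ := exists_liftedCurve (ψ := ψ) e hpe hesymm he1 (r₁ := fun s ↦ s)
    (r₂ := c) (t₀ := 0) analyticAt_id hcan (by rw [hp0]) (by rw [hc0, hp2])
  have hΓcont : ContinuousAt Γ 0 := hΓd0.continuousAt
  -- continuity along `Γ`: `f₁`, `z₂`, `z₃`
  have hcoordcont : ∀ r, ContinuousAt (fun s ↦ projLift ψ 1 (Γ s) r) 0 := by
    intro r
    have h1 : ContinuousAt (fun x ↦ projLift ψ 1 x r) p :=
      ((continuous_apply r).comp_continuousOn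
        (mdifferentiableOn_projLift ψ hhol 1).continuousOn).continuousAt
        ((isOpen_liftDomain ψ hψc 1).mem_nhds hp)
    rw [← hΓ0] at h1
    exact h1.comp hΓcont
  have hlow : ∀ r, projLift ψ 1 p r ≠ 0 →
      ∀ᶠ s in 𝓝 (0 : ℂ), ‖projLift ψ 1 p r‖ / 2 ≤ ‖projLift ψ 1 (Γ s) r‖ := by
    intro r hr
    have ht : Tendsto (fun s ↦ ‖projLift ψ 1 (Γ s) r‖) (𝓝 0) (𝓝 ‖projLift ψ 1 p r‖) := by
      have := (hcoordcont r).norm.tendsto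
      rwa [hΓ0] at this
    have hlt : ‖projLift ψ 1 p r‖ / 2 < ‖projLift ψ 1 p r‖ := by
      have := norm_pos_iff.mpr hr; linarith
    exact (ht.eventually (lt_mem_nhds hlt)).mono fun s hs ↦ hs.le
  have hf₁bd : ∀ᶠ s in 𝓝 (0 : ℂ), ‖f₁ (Γ s)‖ ≤ ‖f₁ p‖ + 1 := by
    have h1 := hf₁c p hp
    rw [← hΓ0] at h1
    have ht : Tendsto (fun s ↦ ‖f₁ (Γ s)‖) (𝓝 0) (𝓝 ‖f₁ p‖) := by
      have := (h1.comp hΓcont).norm.tendsto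
      simp only [Function.comp_apply] at this
      rwa [hΓ0] at this
    exact (ht.eventually (Iio_mem_nhds (by linarith : ‖f₁ p‖ < ‖f₁ p‖ + 1))).mono
      fun s hs ↦ hs.le
  -- the constant and the bound along `Γ`
  set κ : ℝ := (‖c₀‖ / 2) ^ ((β 2).val - 1) * (‖c₀'‖ / 2) ^ ((β 3).val - 1) with hκ
  have hκpos : 0 < κ := by
    have h1 : 0 < ‖c₀‖ / 2 := by have := norm_pos_iff.mpr hc₀0; linarith
    have h2' : 0 < ‖c₀'‖ / 2 := by have := norm_pos_iff.mpr hc₀'0; linarith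
    positivity
  set K : ℝ := (‖f₁ p‖ + 1) / κ with hK
  have hKpos : 0 < K := by rw [hK]; positivity
  have hΓbound : ∀ᶠ s in 𝓝 (0 : ℂ), s ≠ 0 → ‖s‖ ≤ 1 → Γ s ∈ liftDomain ψ 0 →
      (∀ r, projLift ψ 0 (Γ s) r ≠ 0) → ‖Fq (Γ s)‖ ≤ K * ‖s‖ := by
    filter_upwards [hΓev, hlow 2 (by rw [hp2]; exact hc₀0), hlow 3 (by rw [hp3]; exact hc₀'0),
      hf₁bd] with s hs hl2 hl3 hfs hs0 hs1 hΓ0' hne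
    obtain ⟨hsrc, -, hz0, hz2⟩ := hs
    have hΓ1 : Γ s ∈ liftDomain ψ 1 := (hesrc hsrc).1
    rw [hp2] at hl2
    rw [hp3] at hl3
    have hest := norm_fermatQuotientFn_le_near_infinity hN hb hFq hΓ0' hΓ1 (htrans _ hΓ0' hΓ1)
      (by rw [hz0]; exact hs1)
    rw [hz0] at hest
    refine hest.trans ?_
    have hden : κ ≤ ‖projLift ψ 1 (Γ s) 2‖ ^ ((β 2).val - 1) * ‖projLift ψ 1 (Γ s) 3‖ ^ ((β 3).val - 1) := by
      rw [hκ]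
      gcongr
    calc ‖f₁ (Γ s)‖ * ‖s‖ / (‖projLift ψ 1 (Γ s) 2‖ ^ ((β 2).val - 1) *
          ‖projLift ψ 1 (Γ s) 3‖ ^ ((β 3).val - 1))
        ≤ ‖f₁ (Γ s)‖ * ‖s‖ / κ := div_le_div_of_nonneg_left (by positivity) hκpos hden
      _ ≤ (‖f₁ p‖ + 1) * ‖s‖ / κ := by gcongr
      _ = K * ‖s‖ := by rw [hK]; ring
  -- extract `δ`
  obtain ⟨δ₀, hδ₀pos, hδ₀⟩ := Metric.eventually_nhds_iff.mp (hΓbound.and hΓev)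
  set δ : ℝ := min δ₀ (min 1 (ε / K)) with hδ
  have hδpos : 0 < δ := by rw [hδ]; positivity
  refine ⟨δ, hδpos, fun x hx₀ hx₁ hne hzδ hline ↦ ?_⟩
  set s : ℂ := projLift ψ 1 x 0 with hsdef
  have hs0 : s ≠ 0 := by
    intro h0
    have := projLift_eq_smul_of_mem ψ hx₁ hx₀
    rw [← hsdef, h0, inv_zero, zero_smul] at this
    exact projLift_ne_zero ψ 0 x this
  have hsδ₀ : dist s 0 < δ₀ := by
    have : ‖s‖ < δ₀ := lt_of_lt_of_le hzδ (min_le_left _ _)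
    simpa using this
  have hs1 : ‖s‖ ≤ 1 := (lt_of_lt_of_le hzδ ((min_le_right _ _).trans (min_le_left _ _))).le
  have hsε : ‖s‖ < ε / K := lt_of_lt_of_le hzδ ((min_le_right _ _).trans (min_le_right _ _))
  obtain ⟨hbound, hsrc, -, hz0, hz2⟩ := hδ₀ hsδ₀
  have hΓ1 : Γ s ∈ liftDomain ψ 1 := (hesrc hsrc).1
  -- `Γ s ∈ M₀` since `z₀ (Γ s) = s ≠ 0`
  have hΓ0' : Γ s ∈ liftDomain ψ 0 := by
    rw [mem_liftDomain_iff, stdChart_source, ← mk_projLift ψ hΓ1, mk_mem_stdChartSource_iff, hz0]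
    exact hs0
  -- same fibre: the `z`-data agree in `m`-th powers, hence so do the `y`-data
  have hzx1 : projLift ψ 1 x 1 = 1 := projLift_apply_self ψ 1 x
  have hzΓ1 : projLift ψ 1 (Γ s) 1 = 1 := projLift_apply_self ψ 1 (Γ s)
  have hzpow : ∀ r, projLift ψ 1 x r ^ m = projLift ψ 1 (Γ s) r ^ m := by
    have hr0 : projLift ψ 1 x 0 ^ m = projLift ψ 1 (Γ s) 0 ^ m := by rw [hz0]
    have hr1 : projLift ψ 1 x 1 ^ m = projLift ψ 1 (Γ s) 1 ^ m := by rw [hzx1, hzΓ1]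
    have hr2 : projLift ψ 1 x 2 ^ m = projLift ψ 1 (Γ s) 2 ^ m := by rw [hz2, hcpow, hline]
    have hr3 : projLift ψ 1 x 3 ^ m = projLift ψ 1 (Γ s) 3 ^ m := by
      have hx' := sum_projLift_pow_eq_zero hrange.le hx₁
      have hΓ' := sum_projLift_pow_eq_zero hrange.le hΓ1
      rw [Fin.sum_univ_four] at hx' hΓ'
      rw [hr0, hr1, hr2] at hx'
      linear_combination hx' - hΓ'
    intro r
    fin_cases r
    exacts [hr0, hr1, hr2, hr3]
  have hypow : ∀ r, projLift ψ 0 x r ^ m = projLift ψ 0 (Γ s) r ^ m := by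
    intro r
    rw [projLift_eq_smul_of_mem ψ hx₁ hx₀, projLift_eq_smul_of_mem ψ hΓ1 hΓ0', Pi.smul_apply,
      Pi.smul_apply, smul_eq_mul, smul_eq_mul, mul_pow, mul_pow, hzpow r, ← hsdef, hz0]
  -- the coordinates of `Γ s` do not vanish either
  have hneΓ : ∀ r, projLift ψ 0 (Γ s) r ≠ 0 := fun r h0 ↦ by
    have := hypow r
    rw [h0, zero_pow hm] at this
    exact hne r ((pow_eq_zero_iff hm).mp this)
  have hFeq := fermatQuotientFn_eq_of_pow_eq hΦψ hinj hb hsum hf₀ hFq hx₀ hΓ0' hypow hne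
  rw [← hFeq]
  calc ‖Fq (Γ s)‖ ≤ K * ‖s‖ := hbound hs0 hs1 hΓ0' hneΓ
    _ ≤ K * (ε / K) := by gcongr
    _ = ε := by field_simp

end Surface

end Literature.AlgebraicGeometry.HodgeTheory

end
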